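/-
Copyright (c) 2026. All rights reserved.
Released under Apache 2.0 license as described in the file LICENSE.
-/
import Literature.Geometry.Kaehler.ComplexTorusQuaternionMaximalOrderNormaliser
import HarnessLib

/-!
# `N(𝔬)/ℚ^×𝔬^× ≅ D₆` has EXACTLY twelve elements: the classes `[vE^m(1 + i)^kμ^l]`, `m ≤ 2`, `k, l ≤ 1`, exhaust the
# normaliser of Lang's order `𝔬 = ℤ⟨1, i, j, ij⟩ ⊂ (−1,3)_ℚ` and are pairwise distinct (completing g28's `…DihedralNormaliser`)

[tag: complex_torus] [tag: abelian_surface] [tag: quaternion_multiplication] [tag: shimura_curve] [tag: atkin_lehner]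

Lane `lit-hodgefound`, seat p12, row g33-#9 — THEOREMS ONLY (no definition, no named fact, no instance); closes the
«Honest scope» of `…DihedralNormaliser` («no claim is made that these twelve classes EXHAUST `N(𝔬)/ℚ^×𝔬^×` … pairwise
distinct … NOT spelled out») using g33-#4 `…MaximalOrderNormaliser` (`normalises_order_iff_exists`:
`N(𝔬) = N(O₆) = ℚ^×_{>0}·O₆^{±1}·{1, w₂, μ, w₂μ}`) and g2x `exists_order_mul_e_pow` (`O₆^{±1} = 𝔬^{±1}·{1, E, E²}`, `E = e²`).
Setting: `B = (−1,3)_ℚ`, `𝔬 = order (-1) 3`, `e = (1 + i + j − ij)/2`, **`E = e² = (3 + i + j − ij)/2`** (`EĒ = 1`), `w₂ = 1 + i`,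
`μ = 3 + j + ij`; `g ∈ N(𝔬)` as the pair of inclusions `g𝔬 ⊆ 𝔬g`, `𝔬g ⊆ g𝔬`.

## The print

* P. Bayer, A. Travesa (2007) [BayerTravesa2007] §2 p. 318: «the group of units modulo `ℚ*` of the normalizer `N(O₆)` …
  `Γ₆⁺/Γ₆ ≅ (ℤ/2ℤ)²`» — with `[O₆^{±1} : 𝔬^{±1}] = 3` (g30-#4: `O₆¹ = Γ ⊔ Γe² ⊔ Γe⁴`) this makes `N(𝔬)/ℚ^×𝔬^{±1}` a group of
  order `12` (the dihedral `D₆` of `…DihedralNormaliser`: `[w₂]` inverts `[E]`, `[μ]` central).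
* M.-F. Vignéras (1980) [VignerasLNM800] Ch. I §4 ex. 4.6 (normaliser of an order modulo `K^×𝒪^×`), Ch. IV §3 B.
* A. P. Ogg (1983) [Ogg1983RealPoints] §2 p. 283 (`W ≅ C₂^r` for a maximal/Eichler order).

## What is proved

* §1 **EXHAUSTION** (`normalises_order_iff_exists_twelve`): for `g ≠ 0`, `g ∈ N(𝔬)` iff `g = q·vE^m w₂^k μ^l` with
  `q ∈ ℚ_{>0}`, `v ∈ 𝔬`, `vv̄ = ±1`, `m ∈ {0, 1, 2}`, `k, l ∈ {0, 1}`.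
* §2 **DISTINCTNESS** (`twelve_classes_injective`): if `q·vE^m w₂^k μ^l = q'·v'E^{m'} w₂^{k'} μ^{l'}` with `q, q' > 0`,
  `v, v' ∈ 𝔬^{±1}` and exponents in range, then `(m, k, l) = (m', k', l')` — norms give `q²·2^k3^l = q'²·2^{k'}3^{l'}`
  (`2, 3, 6, 12, 18` are not squares — decided by `norm_num`), and then `E^mĒ^{m'} ∈ ±(q'/q)·𝔬` forces `m = m'` since `±E, ±Ē, ±E², ±Ē²` have
  real part `±3/2, ±7/2 ∉ ℤ`. Hence **`|N(𝔬)/ℚ^×𝔬^{±1}| = 12`** exactly.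

## Honest scope

No quotient group is constructed: «twelve classes» is the pair (surjectivity §1, injectivity §2) for the explicit
parametrisation `(v, m, k, l) ↦ ℚ^×_{>0}·vE^m w₂^k μ^l`, `v ∈ 𝔬^{±1}`; the group law (`D₆`) is `…DihedralNormaliser` §2.
0 definitions, 0 named facts, 0 instances — net debt `0`.

## References
* [BayerTravesa2007] P. Bayer, A. Travesa, *Uniformizing functions for certain Shimura curves, in the case D = 6*, Acta
  Arith. 126 (2007), §§1–2 pp. 316–318.
* [VignerasLNM800] M.-F. Vignéras, *Arithmétique des algèbres de quaternions*, LNM 800 (1980), Ch. I §4 ex. 4.6, Ch. IV §3 B.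
* [Ogg1983RealPoints] A. P. Ogg, *Real points on Shimura curves*, Progr. Math. 35 (1983), §2 p. 283.
-/

noncomputable section

set_option maxSynthPendingDepth 3

open Quaternion Function

namespace Literature.Geometry.Kaehler.ComplexTorus.QuaternionType

/-! ## §0 Bookkeeping: `E = e²`, norms of powers, half-integral real parts -/

section Prelim

/-- `EĒ = 1` for `E = e² = (3 + i + j − ij)/2`. [cite: BayerTravesa2007, §1] -/
theorem eSq_mul_star : (⟨3/2, 1/2, 1/2, -1/2⟩ : ℍ[ℚ,((-1 : ℤ) : ℚ),((3 : ℤ) : ℚ)]) * star ⟨3/2, 1/2, 1/2, -1/2⟩ = 1 := by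
  have h := e_sq_mul_star_and.1
  rwa [e_sq_eq] at h

/-- `E = e² ∈ O₆` (`E − e = 1 ∈ 𝔬`). [cite: BayerTravesa2007, §1] -/
theorem eSq_maxOrder :
    (⟨3/2, 1/2, 1/2, -1/2⟩ : ℍ[ℚ,((-1 : ℤ) : ℚ),((3 : ℤ) : ℚ)]) ∈ order (-1) 3 ∨
      (⟨3/2, 1/2, 1/2, -1/2⟩ : ℍ[ℚ,((-1 : ℤ) : ℚ),((3 : ℤ) : ℚ)]) - ⟨1/2, 1/2, 1/2, -1/2⟩ ∈ order (-1) 3 := by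
  right
  rw [QuaternionAlgebra.mk_sub_mk]
  norm_num
  exact ⟨![1, 0, 0, 0], by ext <;> simp [ofCoords]⟩

/-- `E^n ∈ O₆`. [cite: BayerTravesa2007, §1] -/
theorem eSq_pow_maxOrder (n : ℕ) :
    (⟨3/2, 1/2, 1/2, -1/2⟩ : ℍ[ℚ,((-1 : ℤ) : ℚ),((3 : ℤ) : ℚ)]) ^ n ∈ order (-1) 3 ∨
      (⟨3/2, 1/2, 1/2, -1/2⟩ : ℍ[ℚ,((-1 : ℤ) : ℚ),((3 : ℤ) : ℚ)]) ^ n - ⟨1/2, 1/2, 1/2, -1/2⟩ ∈ order (-1) 3 := by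
  induction n with
  | zero => exact Or.inl (by rw [pow_zero]; exact Subring.one_mem _)
  | succ n ih => rw [pow_succ]; exact maxOrder_mul ih eSq_maxOrder

/-- `nr(x^n) = (nr x)^n`. [folklore] -/
private theorem re_pow_mul_star_pow (x : ℍ[ℚ,((-1 : ℤ) : ℚ),((3 : ℤ) : ℚ)]) (n : ℕ) :
    (x ^ n * star (x ^ n)).re = ((x * star x).re) ^ n := by
  induction n with
  | zero => rw [pow_zero, pow_zero, star_one, mul_one, QuaternionAlgebra.re_one]
  | succ n ih => rw [pow_succ, re_mul_mul_star_mul, ih, pow_succ]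

/-- `nr(q·x) = q²·nr x`. [folklore] -/
private theorem norm_smul_eq'' (q : ℚ) (x : ℍ[ℚ,((-1 : ℤ) : ℚ),((3 : ℤ) : ℚ)]) :
    ((q • x) * star (q • x)).re = q ^ 2 * (x * star x).re := by
  obtain ⟨x₀, x₁, x₂, x₃⟩ := x
  simp only [QuaternionAlgebra.smul_mk, smul_eq_mul, QuaternionAlgebra.star_mk, QuaternionAlgebra.mk_mul_mk]
  ring

/-- `(wE^m)(wE^m)‾ = ww̄`: right multiplication by a power of `E` does not change `xx̄`. [folklore] -/
private theorem mul_eSq_pow_mul_star (w : ℍ[ℚ,((-1 : ℤ) : ℚ),((3 : ℤ) : ℚ)]) (m : ℕ) :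
    w * (⟨3/2, 1/2, 1/2, -1/2⟩ : ℍ[ℚ,((-1 : ℤ) : ℚ),((3 : ℤ) : ℚ)]) ^ m *
        star (w * (⟨3/2, 1/2, 1/2, -1/2⟩ : ℍ[ℚ,((-1 : ℤ) : ℚ),((3 : ℤ) : ℚ)]) ^ m) = w * star w := by
  induction m with
  | zero => rw [pow_zero, mul_one]
  | succ n ih =>
    rw [pow_succ, ← mul_assoc, star_mul, ← mul_assoc, mul_assoc (w * _ ^ n), eSq_mul_star, mul_one, ih]

/-- An element of `𝔬` has integral real part: `2 re x` odd ⟹ `x ∉ 𝔬`. [folklore] -/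
private theorem not_mem_order_of_two_mul_re {x : ℍ[ℚ,((-1 : ℤ) : ℚ),((3 : ℤ) : ℚ)]} {j : ℤ}
    (hx : 2 * x.re = 2 * j + 1) : x ∉ order (-1) 3 := by
  rintro ⟨n, hn⟩
  have h := congrArg QuaternionAlgebra.re hn
  simp only [ofCoords_re] at h
  have h' : (2 : ℤ) * n 0 = 2 * j + 1 := by
    have : (2 : ℚ) * n 0 = 2 * j + 1 := by rw [← hx, ← h]
    exact_mod_cast this
  omega

end Prelim

/-! ## §1 Exhaustion -/

section Exhaustion

/-- **`N(𝔬)` IS EXHAUSTED BY THE TWELVE CLASSES `[vE^m w₂^k μ^l]`**: for `g ≠ 0`, `g𝔬 = 𝔬g` iff `g = q·(vE^m(1 + i)^kμ^l)`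
with `q > 0`, `v ∈ 𝔬`, `vv̄ = ±1`, `m ≤ 2`, `k, l ≤ 1` — g33-#4 (`N(𝔬) = ℚ^×O₆^{±1}{1, w₂, μ, w₂μ}`) and
`O₆^{±1} = 𝔬^{±1}{1, E, E²}` (g30-#4). [cite: BayerTravesa2007, §2 p. 318] [cite: VignerasLNM800, Ch. I §4 ex. 4.6 and Ch. IV §3 B] -/
theorem normalises_order_iff_exists_twelve {g : ℍ[ℚ,((-1 : ℤ) : ℚ),((3 : ℤ) : ℚ)]} (hg0 : g ≠ 0) :
    ((∀ x ∈ order (-1) 3, ∃ y ∈ order (-1) 3, g * x = y * g) ∧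
      (∀ y ∈ order (-1) 3, ∃ x ∈ order (-1) 3, y * g = g * x)) ↔
      ∃ (q : ℚ) (v : ℍ[ℚ,((-1 : ℤ) : ℚ),((3 : ℤ) : ℚ)]) (m k l : ℕ), 0 < q ∧ v ∈ order (-1) 3 ∧
        (v * star v = 1 ∨ v * star v = -1) ∧ m ≤ 2 ∧ k ≤ 1 ∧ l ≤ 1 ∧
        g = q • (v * (⟨3/2, 1/2, 1/2, -1/2⟩ : ℍ[ℚ,((-1 : ℤ) : ℚ),((3 : ℤ) : ℚ)]) ^ m * ⟨1, 1, 0, 0⟩ ^ k *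
          ⟨3, 0, 1, 1⟩ ^ l) := by
  rw [normalises_order_iff_exists hg0]
  constructor
  · rintro ⟨q, u, k, l, hq, hu, hu1, hk, hl, rfl⟩
    obtain ⟨v, hv, huv⟩ := exists_order_mul_e_pow hu
    rw [e_sq_eq] at huv
    have hvn : v * star v = 1 ∨ v * star v = -1 := by
      rcases huv with rfl | rfl | rfl
      · exact hu1
      · rwa [← pow_one (⟨3/2, 1/2, 1/2, -1/2⟩ : ℍ[ℚ,((-1 : ℤ) : ℚ),((3 : ℤ) : ℚ)]), mul_eSq_pow_mul_star] at hu1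
      · rwa [mul_assoc v, ← pow_two, mul_eSq_pow_mul_star] at hu1
    rcases huv with rfl | rfl | rfl
    · exact ⟨q, u, 0, k, l, hq, hv, hvn, by norm_num, hk, hl, by rw [pow_zero, mul_one]⟩
    · exact ⟨q, v, 1, k, l, hq, hv, hvn, by norm_num, hk, hl, by rw [pow_one]⟩
    · exact ⟨q, v, 2, k, l, hq, hv, hvn, le_rfl, hk, hl, by rw [pow_two, mul_assoc v]⟩
  · rintro ⟨q, v, m, k, l, hq, hv, hv1, -, hk, hl, rfl⟩
    refine ⟨q, v * (⟨3/2, 1/2, 1/2, -1/2⟩ : ℍ[ℚ,((-1 : ℤ) : ℚ),((3 : ℤ) : ℚ)]) ^ m, k, l, hq,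
      maxOrder_mul (Or.inl hv) (eSq_pow_maxOrder m), ?_, hk, hl, rfl⟩
    rwa [mul_eSq_pow_mul_star]

end Exhaustion

/-! ## §2 Distinctness -/

section Distinctness

/-- The key cancellation: `q·vZ = q'·v'Z'` with `q, q' > 0`, `v, v' ∈ 𝔬^{±1}`, `ZZ̄ = Z'Z̄' = 1` forces `±ZZ̄' = v̄v' ∈ 𝔬`.
[folklore] -/
private theorem mem_order_of_smul_eq {q q' : ℚ} (hq : 0 < q) (hq' : 0 < q')
    {v v' Z Z' : ℍ[ℚ,((-1 : ℤ) : ℚ),((3 : ℤ) : ℚ)]}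
    (hv : v ∈ order (-1) 3) (hv1 : v * star v = 1 ∨ v * star v = -1) (hv' : v' ∈ order (-1) 3)
    (hv'1 : v' * star v' = 1 ∨ v' * star v' = -1) (hZ : Z * star Z = 1) (hZ' : Z' * star Z' = 1)
    (h : q • (v * Z) = q' • (v' * Z')) : Z * star Z' ∈ order (-1) 3 ∨ -(Z * star Z') ∈ order (-1) 3 := by
  have hsv : star v * v = 1 ∨ star v * v = -1 := by
    rcases hv1 with h1 | h1
    · exact Or.inl (by rw [star_comm_self', h1])
    · exact Or.inr (by rw [star_comm_self', h1])
  have hsZ' : star Z' * Z' = 1 := by rw [star_comm_self', hZ']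
  have key := congrArg (fun z ↦ star v * z * star Z') h
  simp only [mul_smul_comm, smul_mul_assoc] at key
  rw [← mul_assoc, ← mul_assoc, mul_assoc (star v * v'), hZ', mul_one, mul_assoc (star v * v)] at key
  -- `key : q • ((v̄v)(ZZ̄')) = q' • (v̄v')`
  have hy : star v * v' ∈ order (-1) 3 := Subring.mul_mem _ (star_mem_order hv) hv'
  have hyn : (star v * v') * star (star v * v') = 1 ∨ (star v * v') * star (star v * v') = -1 := by
    rw [star_mul, star_star, mul_assoc, ← mul_assoc v']
    rcases hv'1 with e | e <;> rw [e]
    · rw [one_mul]; exact hsv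
    · rw [neg_one_mul, mul_neg]
      rcases hsv with e' | e' <;> rw [e']
      · exact Or.inr rfl
      · exact Or.inl (neg_neg 1)
  have hWn : (Z * star Z') * star (Z * star Z') = 1 := by
    rw [star_mul, star_star, mul_assoc, ← mul_assoc (star Z'), hsZ', one_mul, hZ]
  have hX : ∀ s : ℍ[ℚ,((-1 : ℤ) : ℚ),((3 : ℤ) : ℚ)], (s = 1 ∨ s = -1) →
      ((s * (Z * star Z')) * star (s * (Z * star Z'))).re = 1 := by
    rintro s (rfl | rfl)
    · rw [one_mul, hWn, QuaternionAlgebra.re_one]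
    · rw [neg_one_mul, star_neg, neg_mul_neg, hWn, QuaternionAlgebra.re_one]
  have hn := congrArg (fun z : ℍ[ℚ,((-1 : ℤ) : ℚ),((3 : ℤ) : ℚ)] ↦ (z * star z).re) key
  simp only [norm_smul_eq''] at hn
  rw [hX _ hsv, mul_one] at hn
  rcases hyn with e3 | e3
  · rw [e3, QuaternionAlgebra.re_one, mul_one] at hn
    have hqq : q = q' := by nlinarith
    rw [hqq] at key
    have hc := congrArg (fun z ↦ q'⁻¹ • z) key
    simp only [smul_smul, inv_mul_cancel₀ hq'.ne', one_smul] at hc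
    rcases hsv with e | e
    · left
      rw [e, one_mul] at hc
      rw [hc]
      exact hy
    · right
      rw [e, neg_one_mul] at hc
      rw [hc]
      exact hy
  · rw [e3, QuaternionAlgebra.re_neg, QuaternionAlgebra.re_one] at hn
    nlinarith [sq_nonneg q, sq_nonneg q', mul_pos hq hq, mul_pos hq' hq']

/-- **THE TWELVE CLASSES ARE PAIRWISE DISTINCT**: `q·vE^m w₂^k μ^l = q'·v'E^{m'} w₂^{k'} μ^{l'}` (`q, q' > 0`, `v, v' ∈ 𝔬^{±1}`,
`m, m' ≤ 2`, `k, l, k', l' ≤ 1`) forces `m = m'`, `k = k'`, `l = l'`. With §1: **`|N(𝔬)/ℚ^×𝔬^{±1}| = 12`** (`D₆`).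
[cite: BayerTravesa2007, §2 p. 318 («`Γ₆⁺/Γ₆ ≅ (ℤ/2ℤ)²`»)] [cite: VignerasLNM800, Ch. IV §3 B] -/
theorem twelve_classes_injective {q q' : ℚ} (hq : 0 < q) (hq' : 0 < q') {v v' : ℍ[ℚ,((-1 : ℤ) : ℚ),((3 : ℤ) : ℚ)]}
    (hv : v ∈ order (-1) 3) (hv1 : v * star v = 1 ∨ v * star v = -1) (hv' : v' ∈ order (-1) 3)
    (hv'1 : v' * star v' = 1 ∨ v' * star v' = -1) {m k l m' k' l' : ℕ} (hm : m ≤ 2) (hk : k ≤ 1) (hl : l ≤ 1)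
    (hm' : m' ≤ 2) (hk' : k' ≤ 1) (hl' : l' ≤ 1)
    (h : q • (v * (⟨3/2, 1/2, 1/2, -1/2⟩ : ℍ[ℚ,((-1 : ℤ) : ℚ),((3 : ℤ) : ℚ)]) ^ m * ⟨1, 1, 0, 0⟩ ^ k * ⟨3, 0, 1, 1⟩ ^ l) =
      q' • (v' * (⟨3/2, 1/2, 1/2, -1/2⟩ : ℍ[ℚ,((-1 : ℤ) : ℚ),((3 : ℤ) : ℚ)]) ^ m' * ⟨1, 1, 0, 0⟩ ^ k' * ⟨3, 0, 1, 1⟩ ^ l')) :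
    m = m' ∧ k = k' ∧ l = l' := by
  -- Step 1: norms. `nr(vE^m w₂^k μ^l) = (±1)·2^k·3^l`
  have hw2 : ((⟨1, 1, 0, 0⟩ : ℍ[ℚ,((-1 : ℤ) : ℚ),((3 : ℤ) : ℚ)]) * star ⟨1, 1, 0, 0⟩).re = 2 := by
    rw [QuaternionAlgebra.star_mk, QuaternionAlgebra.mk_mul_mk]; norm_num
  have hmu : ((⟨3, 0, 1, 1⟩ : ℍ[ℚ,((-1 : ℤ) : ℚ),((3 : ℤ) : ℚ)]) * star ⟨3, 0, 1, 1⟩).re = 3 := by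
    rw [QuaternionAlgebra.star_mk, QuaternionAlgebra.mk_mul_mk]; norm_num
  have hEn : ((⟨3/2, 1/2, 1/2, -1/2⟩ : ℍ[ℚ,((-1 : ℤ) : ℚ),((3 : ℤ) : ℚ)]) * star ⟨3/2, 1/2, 1/2, -1/2⟩).re = 1 := by
    rw [eSq_mul_star, QuaternionAlgebra.re_one]
  have hs : ∀ {w : ℍ[ℚ,((-1 : ℤ) : ℚ),((3 : ℤ) : ℚ)]}, (w * star w = 1 ∨ w * star w = -1) →
      ((w * star w).re = 1 ∨ (w * star w).re = -1) := by
    intro w hw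
    rcases hw with e | e
    · left; rw [e, QuaternionAlgebra.re_one]
    · right; rw [e, QuaternionAlgebra.re_neg, QuaternionAlgebra.re_one]
  have hn := congrArg (fun z : ℍ[ℚ,((-1 : ℤ) : ℚ),((3 : ℤ) : ℚ)] ↦ (z * star z).re) h
  simp only [norm_smul_eq'', re_mul_mul_star_mul, re_pow_mul_star_pow, hw2, hmu, hEn, one_pow, mul_one] at hn
  have A2 : (0 : ℚ) < 2 ^ k * 3 ^ l := by positivity
  have A2' : (0 : ℚ) < 2 ^ k' * 3 ^ l' := by positivity
  have heq : q ^ 2 * (2 ^ k * 3 ^ l) = q' ^ 2 * (2 ^ k' * 3 ^ l') := by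
    rcases hs hv1 with e1 | e1 <;> rcases hs hv'1 with e2 | e2 <;> rw [e1, e2] at hn <;>
      linarith [mul_pos (pow_pos hq 2) A2, mul_pos (pow_pos hq' 2) A2']
  have hsq : IsSquare ((2 ^ k * 3 ^ l) * (2 ^ k' * 3 ^ l') : ℕ) := by
    by_contra hns
    refine sq_mul_natCast_ne hns (q / q') ?_
    push_cast
    rw [div_pow, div_mul_eq_mul_div, div_eq_iff (pow_ne_zero 2 hq'.ne'), heq]
    ring
  have hkl : k = k' ∧ l = l' := by
    -- `norm_num` decides `IsSquare n` for the twelve off-diagonal products `2, 3, 6, 12, 18`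
    interval_cases k <;> interval_cases l <;> interval_cases k' <;> interval_cases l' <;> norm_num at hsq <;>
      exact ⟨rfl, rfl⟩
  obtain ⟨rfl, rfl⟩ := hkl
  refine ⟨?_, rfl, rfl⟩
  -- Step 2: cancel `W = w₂^k μ^l` on the right (`WW̄ = 2^k3^l ∈ ℚ^×`) and compare the `E`-parts
  have hWW : ((⟨1, 1, 0, 0⟩ : ℍ[ℚ,((-1 : ℤ) : ℚ),((3 : ℤ) : ℚ)]) ^ k * ⟨3, 0, 1, 1⟩ ^ l) *
      star ((⟨1, 1, 0, 0⟩ : ℍ[ℚ,((-1 : ℤ) : ℚ),((3 : ℤ) : ℚ)]) ^ k * ⟨3, 0, 1, 1⟩ ^ l) =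
      (((2 : ℚ) ^ k * 3 ^ l : ℚ) : ℍ[ℚ,((-1 : ℤ) : ℚ),((3 : ℤ) : ℚ)]) := by
    rw [QuaternionAlgebra.mul_star_eq_coe, re_mul_mul_star_mul, re_pow_mul_star_pow, re_pow_mul_star_pow, hw2, hmu]
  have hc0 : ((2 : ℚ) ^ k * 3 ^ l) ≠ 0 := by positivity
  have h' : q • (v * (⟨3/2, 1/2, 1/2, -1/2⟩ : ℍ[ℚ,((-1 : ℤ) : ℚ),((3 : ℤ) : ℚ)]) ^ m) =
      q' • (v' * (⟨3/2, 1/2, 1/2, -1/2⟩ : ℍ[ℚ,((-1 : ℤ) : ℚ),((3 : ℤ) : ℚ)]) ^ m') := by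
    have h2 : (q • (v * (⟨3/2, 1/2, 1/2, -1/2⟩ : ℍ[ℚ,((-1 : ℤ) : ℚ),((3 : ℤ) : ℚ)]) ^ m)) *
        ((⟨1, 1, 0, 0⟩ : ℍ[ℚ,((-1 : ℤ) : ℚ),((3 : ℤ) : ℚ)]) ^ k * ⟨3, 0, 1, 1⟩ ^ l) =
        (q' • (v' * (⟨3/2, 1/2, 1/2, -1/2⟩ : ℍ[ℚ,((-1 : ℤ) : ℚ),((3 : ℤ) : ℚ)]) ^ m')) *
        ((⟨1, 1, 0, 0⟩ : ℍ[ℚ,((-1 : ℤ) : ℚ),((3 : ℤ) : ℚ)]) ^ k * ⟨3, 0, 1, 1⟩ ^ l) := by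
      rw [smul_mul_assoc, smul_mul_assoc, ← mul_assoc, ← mul_assoc]
      exact h
    have h3 := congrArg (fun z ↦ z * star ((⟨1, 1, 0, 0⟩ : ℍ[ℚ,((-1 : ℤ) : ℚ),((3 : ℤ) : ℚ)]) ^ k * ⟨3, 0, 1, 1⟩ ^ l)) h2
    rw [mul_assoc (q • _), mul_assoc (q' • _), hWW, ← QuaternionAlgebra.coe_commutes, ← QuaternionAlgebra.coe_commutes,
      QuaternionAlgebra.coe_mul_eq_smul, QuaternionAlgebra.coe_mul_eq_smul] at h3
    have h4 := congrArg (fun z ↦ ((2 : ℚ) ^ k * 3 ^ l)⁻¹ • z) h3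
    simp only [inv_smul_smul₀ hc0] at h4
    exact h4
  have hZm : ∀ n : ℕ, n ≤ 2 → (⟨3/2, 1/2, 1/2, -1/2⟩ : ℍ[ℚ,((-1 : ℤ) : ℚ),((3 : ℤ) : ℚ)]) ^ n *
      star ((⟨3/2, 1/2, 1/2, -1/2⟩ : ℍ[ℚ,((-1 : ℤ) : ℚ),((3 : ℤ) : ℚ)]) ^ n) = 1 := by
    intro n _
    have := mul_eSq_pow_mul_star 1 n
    rwa [one_mul, one_mul, star_one] at this
  have hmem : ∀ {Z Z' : ℍ[ℚ,((-1 : ℤ) : ℚ),((3 : ℤ) : ℚ)]}, Z * star Z = 1 → Z' * star Z' = 1 →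
      q • (v * Z) = q' • (v' * Z') →
      (2 * (Z * star Z').re = 2 * 1 + 1 ∨ 2 * (Z * star Z').re = 2 * 3 + 1) → False := by
    intro Z Z' hZ hZ' hh hr
    rcases mem_order_of_smul_eq hq hq' hv hv1 hv' hv'1 hZ hZ' hh with hin | hin
    · rcases hr with hr | hr
      · exact not_mem_order_of_two_mul_re (j := 1) hr hin
      · exact not_mem_order_of_two_mul_re (j := 3) hr hin
    · rcases hr with hr | hr
      · exact not_mem_order_of_two_mul_re (j := -2)
          (by rw [QuaternionAlgebra.re_neg, show ((-2 : ℤ) : ℚ) = -2 by norm_num]; linarith) hin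
      · exact not_mem_order_of_two_mul_re (j := -4)
          (by rw [QuaternionAlgebra.re_neg, show ((-4 : ℤ) : ℚ) = -4 by norm_num]; linarith) hin
  by_contra hne
  refine hmem (hZm m hm) (hZm m' hm') h' ?_
  -- the real part of `E^m Ē^{m'}` for the six off-diagonal pairs: `3/2` or `7/2`
  interval_cases m <;> interval_cases m' <;>
    first
    | exact absurd rfl hne
    | (simp only [pow_zero, pow_one, pow_two, star_one, mul_one, one_mul, QuaternionAlgebra.star_mk,
        QuaternionAlgebra.mk_mul_mk]; norm_num)

end Distinctness

end Literature.Geometry.Kaehler.ComplexTorus.QuaternionType
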